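import Mathlib
import Summits.Schanuel.Schanuel.Theses.DiophantineDichotomy

/-!
# Sketch (crux-ideate, ideator 3, round 1) — crux `KhovanskiiApproxType` (stmt-Schanuel-6116)

First lemmas of the idea card `subthreshold-rigidity`.

* `IsAlgOfHeight α m H` — the route's currency: `α` is a root of a nonzero integer polynomial of
  degree `≤ m` and naive height `≤ H`.
* `NearSilverman P S` — "the square part of disc(P) is at most `S`": every `s` with
  `s² ∣ Res(P, P')` satisfies `s ≤ S`.  For `F = ℚ(α)`, `P` the minimal polynomial of `α`,
  `disc P = [𝒪_F : ℤ[α]]² Δ_F`, so this says `α` is a near-extremal generator for Silverman's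
  inequality `h(α) ≥ log|Δ_F| / (2m(m-1)) - log m / (2(m-1))` (Silverman 1984, Duke 51).
* `SubthresholdRigidity` — the LEVER (conjectural arithmetic rigidity below the Schanuel threshold
  of the intermediate field), budget form: if `β` generates a degree-`r` extension of `F = ℚ(α)`
  of absolute degree `m r` and has naive height `≤ H` (`H₁` = height of `α`), if `F` has no
  automorphism moving `α`, and if the sub-threshold inequality
  `(2+θ) log H ≤ (2(1-θ)m - 2) log H₁` holds, then `α, β` satisfy an INTEGER relation
  `R(α, β) = 0` of `y₂`-degree `≤ r`, `y₁`-degree `≤ L` and height `≤ B` with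
  `L log H₁ + m log B ≤ 3(log H + c(mr)^c)`: the relation's complexity is paid out of the
  height budget of `β` over `F`, so the induced two-variable charge carries no `d·log H`.
* `TwoVarMeasure ξ₁ ξ₂ C κ` — shape of a Lindemann–Weierstrass / codimension-one measure for integer
  polynomials in two variables at `(ξ₁, ξ₂)` with a polynomial small-height penalty `D^κ`.
* `kill_of_relation` — the elementary transport (mean value inequality): an `H`-independent integer
  relation through the challenger `(α, β)` plus the two-variable measure at `(ξ₁, ξ₂)` bounds
  `-log ‖(α, β) - (ξ₁, ξ₂)‖` by a quantity with NO `log H` term (a pure `d^b` contribution in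
  the crux's currency).  Provable now; `sorry` here (sketch).
-/

namespace Summit.Schanuel.Schanuel.Cruxes.KhovanskiiApproxType.Ideate3

open Polynomial

/-- Route currency: `α` is a root of a nonzero `P ∈ ℤ[X]` with `deg P ≤ m` and naive height
`≤ H`. -/
def IsAlgOfHeight (α : ℂ) (m H : ℕ) : Prop :=
  ∃ P : Polynomial ℤ, P ≠ 0 ∧ P.natDegree ≤ m ∧ (∀ k, |P.coeff k| ≤ (H : ℤ)) ∧
    Polynomial.aeval α P = 0

/-- Near-Silverman generator, rendered on the minimal polynomial: the square part of the
discriminant `Res(P, P')` is at most `S` (so `[𝒪_F : ℤ[α]] ≤ S` up to the leading coefficient). -/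
def NearSilverman (P : Polynomial ℤ) (S : ℝ) : Prop :=
  ∀ s : ℕ, ((s : ℤ) ^ 2 ∣ Polynomial.resultant P (Polynomial.derivative P)) → (s : ℝ) ≤ S

/-- **(R) Sub-threshold rigidity** (conjectural; the lever of the card `subthreshold-rigidity`),
in BUDGET FORM.  Below the Schanuel threshold of the intermediate field `F = ℚ(α)` (hypothesis
`(2+θ) log H ≤ (2(1-θ) m - 2) log H₁`, i.e. `|Δ_F| ≥ H^{2+θ}` up to the square part of `disc P`),
a generator `β` of a relative extension `F(β)/F` of degree `r` whose naive height is `≤ H` is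
`α`-polynomially structured WITHIN THE HEIGHT BUDGET: there is a nonzero `R ∈ ℤ[y₁, y₂]` with
`deg_{y₂} R ≤ r`, `deg_{y₁} R ≤ L`, coefficients `≤ B`, `R(α, β) = 0`, and
`L·log H₁ + m·log B ≤ 3 (log H + c (m r)^c)` — the complexity of the relation is paid out of the
height of `β` over `F` (`h(coefficient vector) ≤ (log H)/m + O(r)`), so in the crux's regime the
two-variable measure it is fed sees NO `d · log H` inflation.  The hypothesis "no conjugate of `α`
other than `α` lies in `F`" excludes the Galois-twisted counterexamples (`β` a root of
`A(y) + σ(α) B(y)`, `σ ∈ Aut F`).  The sub-threshold hypothesis is exactly what forbids the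
trivial relation `R = P(y₁)` (`L = m`, `B = H₁`) in the range `log H < (2m/3) log H₁`, which contains the
crux-relevant case of comparable heights.  The absolute factor `3` is provisional: the honest shape
coming from Pell-type cancellations at `≤ L` conjugates is `L·log H₁ + (m - 2L)·log B ≲ log H`. -/
def SubthresholdRigidity : Prop :=
  ∀ θ : ℝ, 0 < θ → ∃ c : ℝ, 0 < c ∧
    ∀ (m r H₁ H : ℕ) (α β : ℂ) (P : Polynomial ℤ),
      2 ≤ m → 1 ≤ r → 2 ≤ H₁ → 2 ≤ H →
      P ≠ 0 → P.natDegree = m → (∀ k, |P.coeff k| ≤ (H₁ : ℤ)) → Polynomial.aeval α P = 0 →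
      Module.finrank ℚ ↥(IntermediateField.adjoin ℚ ({α} : Set ℂ)) = m →
      (∀ α' : ℂ, Polynomial.aeval α' P = 0 → α' ∈ IntermediateField.adjoin ℚ ({α} : Set ℂ) →
        α' = α) →
      Module.finrank ℚ ↥(IntermediateField.adjoin ℚ ({α, β} : Set ℂ)) = m * r →
      IsAlgOfHeight β (m * r) H →
      NearSilverman P ((H₁ : ℝ) ^ (θ * m)) →
      (2 + θ) * Real.log H ≤ (2 * (1 - θ) * m - 2) * Real.log H₁ →
      ∃ (R : MvPolynomial (Fin 2) ℤ) (L B : ℕ), R ≠ 0 ∧ R.degreeOf 1 ≤ r ∧ R.degreeOf 0 ≤ L ∧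
        1 ≤ B ∧ (∀ μ, |R.coeff μ| ≤ (B : ℤ)) ∧
        (L : ℝ) * Real.log H₁ + (m : ℝ) * Real.log B ≤
          3 * (Real.log H + c * ((m : ℝ) * r) ^ c) ∧
        MvPolynomial.aeval ![α, β] R = 0

/-- Shape of a two-variable measure for integer polynomials at the point `(ξ₁, ξ₂)` (for the line:
`ξ = (e^{s₁}, e^{s_j})` at a Lindemann–Weierstrass point, or a codimension-one measure at a
transcendence pair of a free Khovanskii point), with polynomial small-height penalty `D^κ`. -/
def TwoVarMeasure (ξ₁ ξ₂ : ℂ) (C κ : ℝ) : Prop :=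
  ∀ (R : MvPolynomial (Fin 2) ℤ) (D B : ℕ), R ≠ 0 → (∀ i, R.degreeOf i ≤ D) →
    (∀ μ, |R.coeff μ| ≤ (B : ℤ)) → 2 ≤ B →
    Real.exp (-(C * ((D : ℝ) ^ 2 * Real.log B + (D : ℝ) ^ κ))) ≤ ‖MvPolynomial.aeval ![ξ₁, ξ₂] R‖

/-- **Kill lemma** (elementary, provable now — sketch only): an integer relation through the
challenger with `H`-independent height, transported to the transcendental point by the mean value
inequality and fed to the two-variable measure, bounds the quality of the challenger by a
quantity free of `log H`.  Constants are deliberately crude. -/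
theorem kill_of_relation (ξ₁ ξ₂ α β : ℂ) (C κ : ℝ) (hC : 0 < C)
    (hM : TwoVarMeasure ξ₁ ξ₂ C κ) (R : MvPolynomial (Fin 2) ℤ) (D B : ℕ) (hD : 1 ≤ D)
    (hR : R ≠ 0) (hdeg : ∀ i, R.degreeOf i ≤ D) (hcoef : ∀ μ, |R.coeff μ| ≤ (B : ℤ)) (hB : 2 ≤ B)
    (hvan : MvPolynomial.aeval ![α, β] R = 0) (hnear : ‖![α, β] - ![ξ₁, ξ₂]‖ ≤ 1) :
    Real.exp (-(C * ((D : ℝ) ^ 2 * Real.log B + (D : ℝ) ^ κ))) ≤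
      ((D : ℝ) + 1) ^ 2 * B * (2 * D) * (2 + ‖![ξ₁, ξ₂]‖) ^ (2 * D) * ‖![α, β] - ![ξ₁, ξ₂]‖ := by
  sorry

end Summit.Schanuel.Schanuel.Cruxes.KhovanskiiApproxType.Ideate3
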